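/-
Copyright (c) 2026. Released under the Apache 2.0 license.

# The Hoffman–Lovász ratio bound: `α(G) ≤ ϑ(G) ≤ n τ / (k + τ)` for `k`-regular `G` with `A + τI ⪰ 0`

Literature anchor (engines group, SDP-3 idle lane; shared numerical engines serving client
cells — rigour lives in the verifiers; every published number belongs to a client cell's
ledger, not to the engines group).

Lovász (1979, Theorem 9, p. 5): for a regular graph `G` with adjacency eigenvalues
`λ₁ ≥ … ≥ λ_n`, `ϑ(G) ≤ -n λ_n / (λ₁ - λ_n)` (with equality when the automorphism group is
edge-transitive).  Brouwer–Haemers (2012) state the independence-number form as Theorem 3.5.2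
("an unpublished result of Hoffman known as the Hoffman bound or ratio bound":
`α(Γ) ≤ n (-θ_n)/(k - θ_n)` for `Γ` regular of degree `k`) and the `ϑ` form as Proposition 3.7.5,
whose proof is the dual witness `M = J - (n/(k - θ_n)) A ∈ M_Γ` with `θ₁(M) = -nθ_n/(k - θ_n)`.

We formalise the bound over the tree's `lovaszTheta`, in the eigenvalue-free form: the
hypothesis "`θ_n ≥ -τ`" is stated as positive semidefiniteness of `A + τ I` (equivalently, the
Rayleigh bound `xᵀAx ≥ -τ‖x‖²`, `posSemidef_adjMatrix_add_smul_of_rayleigh`).  The proof is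
Brouwer–Haemers': the Knuth dual feasible matrix `J - cA`, `c = n/(k+τ)`, satisfies
`cτ I - (J - cA) = c (A + τI) - J ⪰ 0`, because by Cauchy–Schwarz for the positive semidefinite
form `B = A + τI` and regularity (`B𝟙 = (k+τ)𝟙`),
`(𝟙ᵀx)² (k+τ)² = (𝟙ᵀBx)² ≤ (𝟙ᵀB𝟙)(xᵀBx) = n(k+τ) xᵀBx`; weak duality
(`lovaszTheta_le_of_dual`) then gives `ϑ(G) ≤ cτ = nτ/(k+τ)`, and `α(G) ≤ ϑ(G)`.

* `lovaszTheta_le_ratioBound` — **`ϑ(G) ≤ nτ/(k+τ)`**; `indepNum_le_ratioBound` — Hoffman's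
  **`α(G) ≤ nτ/(k+τ)`**;
* `lovaszTheta_completeGraph` — the example `K_n`: `(n-1)`-regular, `A + I = J ⪰ 0`, so
  `ϑ(K_n) ≤ n/(n-1+1) = 1`, whence `ϑ(K_n) = 1`.

(For the Petersen graph, `k = 3`, `θ_n = -2`, the bound is `10·2/5 = 4 = α = ϑ`:
`Literature.Combinatorics.Optimization.PetersenTheta` verifies that instance with the same witness
`J - 2A`.)
-/
import Mathlib
import Literature.Combinatorics.SimpleGraph.LovaszThetaDual
import HarnessLib

namespace Literature.Combinatorics.SimpleGraph.HoffmanLovaszBound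

open Matrix Finset _root_.SimpleGraph
open Literature.Combinatorics.SimpleGraph

variable {V : Type*} [Fintype V]

/-! ### Two quadratic-form lemmas -/

/-- Cauchy–Schwarz for a positive semidefinite real form: `(uᵀBv)² ≤ (uᵀBu)(vᵀBv)`
(discriminant of `t ↦ (tu+v)ᵀB(tu+v) ≥ 0`). [folklore] -/
@[folklore] private theorem dotProduct_mulVec_sq_le {B : Matrix V V ℝ} (hB : B.PosSemidef) (u v : V → ℝ) :
    (u ⬝ᵥ B *ᵥ v) ^ 2 ≤ (u ⬝ᵥ B *ᵥ u) * (v ⬝ᵥ B *ᵥ v) := by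
  have hsymm : Bᵀ = B := by
    have h := hB.1
    rwa [Matrix.IsHermitian, conjTranspose_eq_transpose_of_trivial] at h
  have hvu : v ⬝ᵥ B *ᵥ u = u ⬝ᵥ B *ᵥ v := by
    rw [dotProduct_mulVec, ← mulVec_transpose, hsymm, dotProduct_comm]
  have hq : ∀ t : ℝ, 0 ≤ (u ⬝ᵥ B *ᵥ u) * (t * t) + 2 * (u ⬝ᵥ B *ᵥ v) * t + v ⬝ᵥ B *ᵥ v := by
    intro t
    have h := hB.dotProduct_mulVec_nonneg (t • u + v)
    simp only [star_trivial, mulVec_add, mulVec_smul, add_dotProduct, dotProduct_add,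
      smul_dotProduct, dotProduct_smul, hvu, smul_eq_mul] at h
    have e : (u ⬝ᵥ B *ᵥ u) * (t * t) + 2 * (u ⬝ᵥ B *ᵥ v) * t + v ⬝ᵥ B *ᵥ v =
        t * (t * (u ⬝ᵥ B *ᵥ u) + u ⬝ᵥ B *ᵥ v) + (t * (u ⬝ᵥ B *ᵥ v) + v ⬝ᵥ B *ᵥ v) := by
      ring
    rw [e]
    exact h
  have hd := discrim_le_zero hq
  rw [discrim] at hd
  nlinarith [hd]

/-- The all-ones matrix `J` has quadratic form `xᵀJx = (Σ_u x_u)²`. [folklore] -/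
@[folklore] private theorem dotProduct_ones_mulVec (x : V → ℝ) :
    x ⬝ᵥ (of fun _ _ => (1 : ℝ) : Matrix V V ℝ) *ᵥ x = (∑ u, x u) ^ 2 := by
  rw [dotProduct_mulVec_eq_sum_mul, sq, sum_mul_sum]
  simp

section Regular

variable [DecidableEq V] {G : SimpleGraph V} [DecidableRel G.Adj] {k : ℕ} {τ : ℝ}

/-- For a `k`-regular graph, `(A + τI)𝟙 = (k + τ)𝟙` (the all-ones vector is an
eigenvector). [folklore] -/
@[folklore] private theorem adjMatrix_add_smul_mulVec_one (hreg : G.IsRegularOfDegree k) (τ : ℝ) :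
    (G.adjMatrix ℝ + τ • (1 : Matrix V V ℝ)) *ᵥ (fun _ => (1 : ℝ)) = fun _ => (k : ℝ) + τ := by
  funext u
  rw [add_mulVec, smul_mulVec, one_mulVec, Pi.add_apply, Pi.smul_apply, smul_eq_mul, mul_one]
  have h := adjMatrix_mulVec_const_apply_of_regular (α := ℝ) (a := 1) hreg (v := u)
  rw [mul_one] at h
  exact congrArg (· + τ) h

/-- The eigenvalue hypothesis in Rayleigh form: if `xᵀAx ≥ -τ xᵀx` for all `x` (i.e. the least
adjacency eigenvalue is `≥ -τ`), then `A + τI ⪰ 0`. [cite: BrouwerHaemers2012, Theorem 3.5.2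
(hypothesis θ_n) and Proposition 3.7.5] -/
theorem posSemidef_adjMatrix_add_smul_of_rayleigh
    (h : ∀ x : V → ℝ, -τ * (x ⬝ᵥ x) ≤ x ⬝ᵥ G.adjMatrix ℝ *ᵥ x) :
    (G.adjMatrix ℝ + τ • (1 : Matrix V V ℝ)).PosSemidef := by
  refine PosSemidef.of_dotProduct_mulVec_nonneg ?_ fun x => ?_
  · have hA : (G.adjMatrix ℝ)ᴴ = G.adjMatrix ℝ := by
      rw [conjTranspose_eq_transpose_of_trivial, transpose_adjMatrix]
    rw [Matrix.IsHermitian, conjTranspose_add, conjTranspose_smul, conjTranspose_one, star_trivial,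
      hA]
  · rw [star_trivial, add_mulVec, dotProduct_add, smul_mulVec, one_mulVec, dotProduct_smul,
      smul_eq_mul]
    linarith [h x]

/-- **The Hoffman–Lovász bound (Lovász 1979, Theorem 9; Brouwer–Haemers, Proposition 3.7.5):**
for a `k`-regular graph `G` on `n` vertices with `A + τI ⪰ 0`, `τ > 0` (least eigenvalue `≥ -τ`),
`ϑ(G) ≤ nτ/(k + τ)`.  Proof: the dual witness `J - (n/(k+τ)) A` and Cauchy–Schwarz, as in the
module docstring. [cite: Lovasz1979, Theorem 9 (p. 5)] [cite: BrouwerHaemers2012, Proposition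
3.7.5] [cite: Knuth1994, §6 (6.1) (dual feasible matrices, weak duality)] -/
theorem lovaszTheta_le_ratioBound [Nonempty V] (hreg : G.IsRegularOfDegree k) (hτ : 0 < τ)
    (hpsd : (G.adjMatrix ℝ + τ • (1 : Matrix V V ℝ)).PosSemidef) :
    lovaszTheta G ≤ Fintype.card V * τ / (k + τ) := by
  set n : ℝ := (Fintype.card V : ℝ) with hn
  have hkτ : 0 < (k : ℝ) + τ := by positivity
  set c : ℝ := n / (k + τ) with hc
  set Bm : Matrix V V ℝ := G.adjMatrix ℝ + τ • (1 : Matrix V V ℝ) with hBm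
  -- the dual matrix `J - c A`
  set M : Matrix V V ℝ := of fun u v => 1 - c * G.adjMatrix ℝ u v with hM
  have hMfeas : IsThetaDualFeasible G M := by
    refine ⟨Matrix.IsHermitian.ext fun u v => ?_, fun u v huv => ?_⟩
    · simp [hM, adjMatrix_apply, adj_comm]
    · simp [hM, adjMatrix_apply, huv]
  have hsM : (n * τ / (k + τ)) • (1 : Matrix V V ℝ) - M = c • Bm - of fun _ _ => (1 : ℝ) := by
    ext u v
    simp only [hM, hBm, hc, Matrix.sub_apply, Matrix.smul_apply, Matrix.add_apply,
      Matrix.one_apply, of_apply, smul_eq_mul]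
    split_ifs <;> ring
  have hpsd' : ((n * τ / (k + τ)) • (1 : Matrix V V ℝ) - M).PosSemidef := by
    rw [hsM]
    refine PosSemidef.of_dotProduct_mulVec_nonneg ?_ fun x => ?_
    · have h1 : (c • Bm)ᴴ = c • Bm := by
        rw [conjTranspose_smul, star_trivial, hpsd.1.eq]
      have h2 : (of fun _ _ => (1 : ℝ) : Matrix V V ℝ)ᴴ = of fun _ _ => (1 : ℝ) := by
        ext u v; simp
      rw [Matrix.IsHermitian, conjTranspose_sub, h1, h2]
    · rw [star_trivial, sub_mulVec, dotProduct_sub, smul_mulVec, dotProduct_smul, smul_eq_mul,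
        dotProduct_ones_mulVec, sub_nonneg]
      -- `(Σ x)² ≤ c · xᵀ B x` by Cauchy–Schwarz against `𝟙`
      have hcs := dotProduct_mulVec_sq_le hpsd (fun _ => (1 : ℝ)) x
      have hone : (fun _ => (1 : ℝ)) ⬝ᵥ Bm *ᵥ x = ((k : ℝ) + τ) * ∑ u, x u := by
        have hsymm : Bmᵀ = Bm := by
          have h := hpsd.1
          rwa [Matrix.IsHermitian, conjTranspose_eq_transpose_of_trivial] at h
        rw [dotProduct_mulVec, ← mulVec_transpose, hsymm, adjMatrix_add_smul_mulVec_one hreg τ]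
        simp [dotProduct, mul_sum]
      have hone' : (fun _ => (1 : ℝ)) ⬝ᵥ Bm *ᵥ (fun _ => (1 : ℝ)) = ((k : ℝ) + τ) * n := by
        rw [adjMatrix_add_smul_mulVec_one hreg τ]
        simp [dotProduct, hn]
        ring
      rw [hone, hone'] at hcs
      have hQ : 0 ≤ x ⬝ᵥ Bm *ᵥ x := by
        have := hpsd.dotProduct_mulVec_nonneg x; rwa [star_trivial] at this
      rw [hc, div_mul_eq_mul_div, le_div_iff₀ hkτ]
      nlinarith [hcs, hQ, hkτ]
  exact lovaszTheta_le_of_dual hMfeas hpsd' (by positivity)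

/-- **Hoffman's ratio bound (Brouwer–Haemers, Theorem 3.5.2): `α(G) ≤ nτ/(k+τ)`** for `k`-regular
`G` with `A + τI ⪰ 0`, `τ > 0` — here read off `α(G) ≤ ϑ(G)` (`le_lovaszTheta_compl_of_isNClique`)
and `lovaszTheta_le_ratioBound`. [cite: BrouwerHaemers2012, Theorem 3.5.2 (Hoffman bound / ratio
bound)] [cite: Lovasz1979, Theorem 9 (p. 5)] -/
theorem indepNum_le_ratioBound [Nonempty V] (hreg : G.IsRegularOfDegree k) (hτ : 0 < τ)
    (hpsd : (G.adjMatrix ℝ + τ • (1 : Matrix V V ℝ)).PosSemidef) :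
    (G.indepNum : ℝ) ≤ Fintype.card V * τ / (k + τ) := by
  obtain ⟨S, hS⟩ := G.exists_isNIndepSet_indepNum
  have h1 : (G.indepNum : ℝ) ≤ lovaszTheta Gᶜᶜ :=
    le_lovaszTheta_compl_of_isNClique ((isNClique_compl G).2 hS)
  rw [compl_compl] at h1
  exact h1.trans (lovaszTheta_le_ratioBound hreg hτ hpsd)

/-- The same two bounds from the Rayleigh hypothesis `xᵀAx ≥ -τ‖x‖²`.
[cite: Lovasz1979, Theorem 9 (p. 5)] [cite: BrouwerHaemers2012, Theorem 3.5.2 and Proposition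
3.7.5] -/
theorem lovaszTheta_le_ratioBound_of_rayleigh [Nonempty V] (hreg : G.IsRegularOfDegree k)
    (hτ : 0 < τ) (h : ∀ x : V → ℝ, -τ * (x ⬝ᵥ x) ≤ x ⬝ᵥ G.adjMatrix ℝ *ᵥ x) :
    (G.indepNum : ℝ) ≤ lovaszTheta G ∧ lovaszTheta G ≤ Fintype.card V * τ / (k + τ) := by
  refine ⟨?_, lovaszTheta_le_ratioBound hreg hτ (posSemidef_adjMatrix_add_smul_of_rayleigh h)⟩
  obtain ⟨S, hS⟩ := G.exists_isNIndepSet_indepNum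
  have h1 : (G.indepNum : ℝ) ≤ lovaszTheta Gᶜᶜ :=
    le_lovaszTheta_compl_of_isNClique ((isNClique_compl G).2 hS)
  rwa [compl_compl] at h1

end Regular

/-! ### Example: complete graphs, `ϑ(K_n) = 1` -/

omit [Fintype V] in
/-- For the complete graph, `A + I = J`. [folklore] -/
@[folklore] private theorem adjMatrix_top_add_one [DecidableEq V] :
    (⊤ : SimpleGraph V).adjMatrix ℝ + (1 : ℝ) • (1 : Matrix V V ℝ) = of fun _ _ => (1 : ℝ) := by
  ext u v
  by_cases h : u = v <;> simp [h]

/-- `J ⪰ 0` (its form is a square, `dotProduct_ones_mulVec`). [folklore] -/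
@[folklore] private theorem posSemidef_ones : (of fun _ _ => (1 : ℝ) : Matrix V V ℝ).PosSemidef := by
  refine PosSemidef.of_dotProduct_mulVec_nonneg (Matrix.IsHermitian.ext fun u v => by simp)
    fun x => ?_
  rw [star_trivial, dotProduct_ones_mulVec]
  positivity

/-- **`ϑ(K_n) = 1`** (`n ≥ 1`): `≤` is the ratio bound with `k = n - 1`, `τ = 1` (`A + I = J ⪰ 0`,
least eigenvalue `-1`), `n·1/(n-1+1) = 1`; `≥` is the tree's `one_le_lovaszTheta`.
[cite: Lovasz1979, Theorem 9 (p. 5)] [cite: BrouwerHaemers2012, Proposition 3.7.5 and §3.7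
(ϑ(K_n) = 1)] -/
theorem lovaszTheta_completeGraph [DecidableEq V] [Nonempty V] :
    lovaszTheta (⊤ : SimpleGraph V) = 1 := by
  refine le_antisymm ?_ (one_le_lovaszTheta _)
  have hreg : (⊤ : SimpleGraph V).IsRegularOfDegree (Fintype.card V - 1) := IsRegularOfDegree.top
  have hpsd : ((⊤ : SimpleGraph V).adjMatrix ℝ + (1 : ℝ) • (1 : Matrix V V ℝ)).PosSemidef := by
    rw [adjMatrix_top_add_one]
    exact posSemidef_ones
  have h := lovaszTheta_le_ratioBound hreg one_pos hpsd
  have hpos : 0 < Fintype.card V := Fintype.card_pos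
  have hn1 : ((Fintype.card V - 1 : ℕ) : ℝ) + 1 = Fintype.card V := by
    rw [Nat.cast_sub hpos, Nat.cast_one]; ring
  rw [hn1, mul_one, div_self (by exact_mod_cast hpos.ne')] at h
  exact h

end Literature.Combinatorics.SimpleGraph.HoffmanLovaszBound
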